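import Summits.CriticalPhenomena.SAWScalingLimit.Theorems.SAWLoopFugacityFlowAvoidanceLimitLocalConnectivityAssembly
import Summits.CriticalPhenomena.SAWScalingLimit.Theorems.SAWLoopFugacityFlowAvoidanceLimitLocalJordanNbhd
import Summits.CriticalPhenomena.SAWScalingLimit.Theorems.SAWLoopFugacityFlowAvoidanceLimitWalkTransfer
import HarnessLib

/-!
# (T) Lattice uniform local connectivity of a Jordan domain at a boundary point — CLOSED
(line `symplectic-fermion-anchor`, crux `SAWLoopFugacityFlow.AvoidanceLimit`, stmt-CriticalPhenomena-10649; lead c4)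

`latticeLocalConnectivity`: for a Jordan domain `D`, a boundary point `p` and `ρ > 0` there is `r > 0` such that,
for all small meshes `δ`, any two vertices of `Ω_δ = meshDomain D δ` whose mesh points are within `r` of `p` are
joined by an `Ω_δ`-walk all of whose vertices stay within `ρ` of `p`. It is the statement `LatticeLocalConnectivity`
of the line's skeleton (stub `stub_latticeLocalConnectivity`), one of the two inputs of the assembly
`uniformBHP_of_localConnectivity_of_crossRatio` of the uniform boundary Harnack principle for the edge-killed walk,
where it makes the Euclidean balls of `UniformBHP` harmless (`Λ ∩ B(p, r) ⊆ S_q`). Proof: the assembly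
`latticeLocalConnectivity_of` (macroscopic-diameter criterion for mesh components + bulk theorem) fed with the local
Jordan neighbourhood with separation `exists_localJordanNbhd` (Carathéodory chart + half-disc image) and the walk
transfer `exists_discreteDomainGraph_walk_of_reachable`. Folklore.
-/

noncomputable section

open scoped Topology
open Filter
open Literature.Probability.RandomPlanarGeometry Literature.Probability.LatticeModels

namespace Summit.CriticalPhenomena.SAWScalingLimit.Theorems.AvoidanceLimit.Anchor

/-- **(T) Lattice uniform local connectivity of `Ω_δ(D)` at a boundary point of a Jordan domain.** [folklore] -/
theorem latticeLocalConnectivity :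
    ∀ (D : JordanDomain) (p : ℂ), p ∈ frontier D.carrier → ∀ ρ : ℝ, 0 < ρ → ∃ r : ℝ, 0 < r ∧
      ∀ᶠ δ in 𝓝[>] (0 : ℝ), ∀ u v : Site 2, u ∈ meshDomain D.carrier δ → v ∈ meshDomain D.carrier δ →
        dist (meshPoint δ u) p < r → dist (meshPoint δ v) p < r →
        ∃ w : (discreteDomainGraph D.carrier δ).Walk u v,
          ∀ z ∈ w.support, z ∈ meshDomain D.carrier δ ∧ dist (meshPoint δ z) p < ρ :=
  latticeLocalConnectivity_of exists_localJordanNbhd exists_discreteDomainGraph_walk_of_reachable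

end Summit.CriticalPhenomena.SAWScalingLimit.Theorems.AvoidanceLimit.Anchor

end
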